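import Literature.Barriers.CriticalPhenomena.PositionSpaceRGNonGibbsianPeierlsCondition
import Literature.Probability.LatticeModels.PSCornerEncoding
import Literature.Combinatorics.SimpleGraph.CycleSpaceSeparatorsGeneral
import Literature.Barriers.CriticalPhenomena.PositionSpaceRGNonGibbsianContours
import HarnessLib

/-!
# Barrier `PositionSpaceRGNonGibbsian`, Theorem 4.3 for all spacings `b ≥ 2`: thick contours of the
# internal-spin system (good sites, labels, contours as `★`-components of the bad set, typing and
# enclosure)

Companion file on the Theorem 4.3 line of
`Literature/Barriers/CriticalPhenomena/PositionSpaceRGNonGibbsian.lean` (van Enter–Fernández–Sokal,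
J. Stat. Phys. **72** (1993) 879, arXiv:hep-lat/9210032, §4.3.2 and App. B.5.3). The source obtains
the low-temperature `+` phase of the internal-spin system with fully alternating image spins (the
input `VEFS1993_plusPhase` of `…Thm43Reduction.lean`) from Pirogov–Sinai theory. The tree proves it
instead by a direct Peierls argument whose contour-erasing map is the exact symmetry
"spin flip ∘ translation by `b e₁`" of that system (files `…Thm43FlipShift.lean`, `…Thm43Peierls.lean`);
this file supplies the contour geometry, in the thick-contour formalism of Friedli–Velenik 2017,
§7.2 (good/bad sites for a goodness radius `R`, contours = `★`-connected components of the bad set,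
exterior and interior `★`-components of the complement from `StarComponents.lean`):

* `ball R u` — the sup-norm ball; `IsGood` — all internal spins in `ball R u` agree; `label` — their
  common value (`label_spec`); `★`-adjacent good sites carry the same label (`label_eq_of_adj`);
* `exists_adj_ne_of_not_isGood` — a bad site has a disagreeing nearest-neighbour bond of internal
  sites inside its ball (internal sites of a ball are joined by nearest-neighbour chains of internal
  sites inside the ball, `boxChain`);
* `IsContourOf ω γ` — `γ` is a `★`-component of the bad set; TYPING: the label is constant on the
  exterior collar `∂^ex(hull γ)` and on the collar `∂^in A` of every interior component `A`
  (`label_eq_extLabel`, `label_eq_compLabel`; Friedli–Velenik Lemma 7.19 via Lemma B.82 of the tree);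
  NEAR: an internal spin within distance `R` of `γ` but off `γ` equals the label of its component;
* ENCLOSURE (`exists_contour_enclosing`): a site separated from the far region by the bad set lies in
  the hull of a single contour (Timár's lemma `minimalSeparator_adjacent_across` with the
  `★`-triangles, `generatesCycles_zdStar`); ANCHOR: such a contour of size `n` lies in `ball (n-1)`.

Nothing is asserted: the file is sorry-free and introduces no named fact (D-0014, D-0026).

## References

* A. C. D. van Enter, R. Fernández, A. D. Sokal, J. Stat. Phys. 72 (1993) 879–1167,
  arXiv:hep-lat/9210032 — §4.3.2 and App. B.5.3 [VanenterFernandezSokal1993].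
* S. Friedli, Y. Velenik, *Statistical Mechanics of Lattice Systems*, CUP 2017, §7.2.1–7.2.6
  (thick contours, Lemma 7.19) and App. B.15 [FriedliVelenik2017].
* Á. Timár, Proc. AMS 141 (2013) 475–480, Lemma 1 [Timar2013].
-/


noncomputable section

namespace Literature.Barriers.CriticalPhenomena.NonGibbs

open Finset Relation SimpleGraph Literature.Probability.LatticeModels
open Literature.Combinatorics.SimpleGraph.CycleSpace

variable {d : ℕ}

/-! ### Sup-norm balls -/

/-- The sup-norm ball `{v : ‖u - v‖_∞ ≤ R}` of radius `R` about `u`, as an order interval of `ℤ^d`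
(Friedli–Velenik's `i + B(R)`). [cite: FriedliVelenik2017, §7.2.1] -/
def ball (R : ℕ) (u : Site d) : Finset (Site d) :=
  Finset.Icc (u - fun _ => (R : ℤ)) (u + fun _ => (R : ℤ))

/-- Membership in the ball, coordinatewise. [cite: FriedliVelenik2017, §7.2.1] -/
theorem mem_ball {R : ℕ} {u v : Site d} : v ∈ ball R u ↔ ∀ i, (u i - v i).natAbs ≤ R := by
  rw [ball, Finset.mem_Icc, Pi.le_def, Pi.le_def]
  simp only [Pi.sub_apply, Pi.add_apply]
  constructor
  · rintro ⟨h1, h2⟩ i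
    have := h1 i; have := h2 i; omega
  · intro h
    exact ⟨fun i => by have := h i; omega, fun i => by have := h i; omega⟩

/-- Membership in the ball is `‖u - v‖_∞ ≤ R`. [cite: FriedliVelenik2017, §7.2.1] -/
theorem mem_ball_iff_supDist {R : ℕ} {u v : Site d} : v ∈ ball R u ↔ supDist u v ≤ R := by
  rw [mem_ball, supDist_le_iff]

/-- The centre lies in its ball. [folklore] -/
theorem mem_ball_self (R : ℕ) (u : Site d) : u ∈ ball R u :=
  mem_ball.2 fun i => by simp

/-- Symmetry of ball membership. [folklore] -/
theorem mem_ball_comm {R : ℕ} {u v : Site d} : v ∈ ball R u ↔ u ∈ ball R v := by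
  rw [mem_ball_iff_supDist, mem_ball_iff_supDist, supDist_comm]

/-- Balls are monotone in the radius. [folklore] -/
theorem ball_mono {R R' : ℕ} (h : R ≤ R') (u : Site d) : ball R u ⊆ ball R' u := fun _ hv =>
  mem_ball.2 fun i => (mem_ball.1 hv i).trans h

/-- `★`-adjacent points are in each other's ball of any radius `≥ 1`. [folklore] -/
theorem mem_ball_of_adj {R : ℕ} (hR : 1 ≤ R) {u v : Site d} (h : (zdStar d).Adj u v) : v ∈ ball R u :=
  mem_ball_iff_supDist.2 ((zdStar_adj.1 h).2.trans hR)

/-- Triangle inequality for ball membership. [folklore] -/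
theorem mem_ball_add {R₁ R₂ : ℕ} {u v w : Site d} (h₁ : v ∈ ball R₁ u) (h₂ : w ∈ ball R₂ v) :
    w ∈ ball (R₁ + R₂) u := by
  rw [mem_ball] at h₁ h₂ ⊢
  intro i
  have := h₁ i; have := h₂ i; omega

/-- The number of points of a ball. [folklore] -/
theorem card_ball (R : ℕ) (u : Site d) : #(ball R u) = (2 * R + 1) ^ d := by
  rw [ball, Pi.card_Icc]
  have h : ∀ i, #(Finset.Icc (((u - fun _ => (R : ℤ)) : Site d) i) (((u + fun _ => (R : ℤ)) : Site d) i)) =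
      2 * R + 1 := fun i => by
    rw [Pi.sub_apply, Pi.add_apply, Int.card_Icc]
    omega
  simp only [h, prod_const, card_univ, Fintype.card_fin]

/-! ### Good sites and labels -/

section Good

variable (b R : ℕ)

/-- **A good site** for the internal-spin configuration `ω` (goodness radius `R`): all internal
(non-image) spins in the sup-norm ball of radius `R` about `u` agree — Friedli–Velenik's
"`#`-correct" sites, here for the internal spins only (the image spins are frozen and alternate) and
with a radius adapted to the spacing `b`. Sites may be image sites; their own (frozen) spin is not
looked at. [cite: FriedliVelenik2017, §7.2.1 (#-correct sites)] -/
def IsGood (ω : SpinConfig (Site d)) (u : Site d) : Prop :=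
  ∀ v ∈ ball R u, ∀ w ∈ ball R u, ¬ IsSpImageSite d b v → ¬ IsSpImageSite d b w → ω v = ω w

/-- **The label** of a site: `+1` if every internal spin in its ball is `+1`, else `-1`; for a good
site this is the common value of the internal spins of the ball (`label_spec`).
[cite: FriedliVelenik2017, §7.2.1 (the label # of a correct site)] -/
def label (ω : SpinConfig (Site d)) (u : Site d) : ℤˣ :=
  open Classical in
  if ∀ v ∈ ball R u, ¬ IsSpImageSite d b v → ω v = 1 then 1 else -1

variable {b R}

/-- At a good site every internal spin of the ball equals the label.
[cite: FriedliVelenik2017, §7.2.1] -/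
theorem label_spec {ω : SpinConfig (Site d)} {u : Site d} (hu : IsGood b R ω u) {v : Site d}
    (hv : v ∈ ball R u) (hvi : ¬ IsSpImageSite d b v) : ω v = label b R ω u := by
  classical
  unfold label
  split_ifs with h
  · exact h v hv hvi
  · push Not at h
    obtain ⟨w, hw, hwi, hw1⟩ := h
    rw [hu v hv w hw hvi hwi]
    rcases Int.units_eq_one_or (ω w) with h1 | h1
    · exact absurd h1 hw1
    · exact h1

/-- A site all of whose internal ball spins equal one value is good. [cite: FriedliVelenik2017, §7.2.1] -/
theorem isGood_of_forall_eq {ω : SpinConfig (Site d)} {u : Site d} {s : ℤˣ}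
    (h : ∀ v ∈ ball R u, ¬ IsSpImageSite d b v → ω v = s) : IsGood b R ω u :=
  fun v hv w hw hvi hwi => by rw [h v hv hvi, h w hw hwi]

/-- If all internal ball spins are `s`, the label is `s` (`R ≥ 1`, `b ≥ 2`: the ball contains an
internal site). [cite: FriedliVelenik2017, §7.2.1] -/
theorem label_eq_of_forall_eq (hd : 1 ≤ d) (hb : 2 ≤ b) (hR : 1 ≤ R) {ω : SpinConfig (Site d)}
    {u : Site d} {s : ℤˣ} (h : ∀ v ∈ ball R u, ¬ IsSpImageSite d b v → ω v = s) : label b R ω u = s := by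
  -- an internal site of the ball: `u` or `u + e₀`
  set i₀ : Fin d := ⟨0, hd⟩
  obtain ⟨z, hz, hzi⟩ : ∃ z ∈ ball R u, ¬ IsSpImageSite d b z := by
    by_cases hui : IsSpImageSite d b u
    · refine ⟨u + Pi.single i₀ 1, mem_ball_of_adj hR (zdGraph_le_zdStar ?_), not_isSpImageSite_of_adj hb hui ?_⟩ <;>
        exact (zdGraph_adj_iff _ _).2 ⟨i₀, Or.inl rfl⟩
    · exact ⟨u, mem_ball_self R u, hui⟩
  rw [← h z hz hzi]
  exact (label_spec (isGood_of_forall_eq h) hz hzi).symm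

/-- **`★`-adjacent good sites carry the same label** (their balls share an internal site; `R ≥ 2`,
`b ≥ 2`). [cite: FriedliVelenik2017, §7.2.1 (neighbouring correct sites have the same label)] -/
theorem label_eq_of_adj (hd : 1 ≤ d) (hb : 2 ≤ b) (hR : 2 ≤ R) {ω : SpinConfig (Site d)} {u u' : Site d}
    (hu : IsGood b R ω u) (hu' : IsGood b R ω u') (hadj : (zdStar d).Adj u u') :
    label b R ω u = label b R ω u' := by
  set i₀ : Fin d := ⟨0, hd⟩
  -- a common internal point of the two balls
  obtain ⟨z, hz, hz', hzi⟩ : ∃ z, z ∈ ball R u ∧ z ∈ ball R u' ∧ ¬ IsSpImageSite d b z := by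
    by_cases hui : IsSpImageSite d b u
    · have hadj0 : (zdGraph d).Adj u (u + Pi.single i₀ 1) := (zdGraph_adj_iff _ _).2 ⟨i₀, Or.inl rfl⟩
      have hR1 : 1 ≤ R := by omega
      refine ⟨u + Pi.single i₀ 1, mem_ball_of_adj hR1 (zdGraph_le_zdStar hadj0), ?_,
        not_isSpImageSite_of_adj hb hui hadj0⟩
      have h1 := mem_ball.1 (mem_ball_of_adj (le_refl 1) hadj.symm)
      have h2 := mem_ball.1 (mem_ball_of_adj (le_refl 1) (zdGraph_le_zdStar hadj0))
      exact mem_ball.2 fun i => by have := h1 i; have := h2 i; omega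
    · have hR1 : 1 ≤ R := by omega
      exact ⟨u, mem_ball_self R u, mem_ball_of_adj hR1 hadj.symm, hui⟩
  rw [← label_spec hu hz hzi, ← label_spec hu' hz' hzi]

/-- Labels are constant along `★`-chains of good sites. [cite: FriedliVelenik2017, §7.2.6, Lemma 7.19] -/
theorem label_eq_of_reflTransGen (hd : 1 ≤ d) (hb : 2 ≤ b) (hR : 2 ≤ R) {ω : SpinConfig (Site d)}
    {C : Set (Site d)} (hC : ∀ c ∈ C, IsGood b R ω c) {x y : Site d}
    (h : ReflTransGen (starRel C) x y) : label b R ω x = label b R ω y := by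
  induction h with
  | refl => rfl
  | tail _ hbc ih => exact ih.trans (label_eq_of_adj hd hb hR (hC _ hbc.2.1) (hC _ hbc.2.2) hbc.1)

/-- **Labels are constant on a `★`-connected set of good sites.**
[cite: FriedliVelenik2017, §7.2.6, Lemma 7.19] -/
theorem label_eq_of_starConn (hd : 1 ≤ d) (hb : 2 ≤ b) (hR : 2 ≤ R) {ω : SpinConfig (Site d)}
    {C : Set (Site d)} (hCconn : StarConn C) (hC : ∀ c ∈ C, IsGood b R ω c) {x y : Site d} (hx : x ∈ C)
    (hy : y ∈ C) : label b R ω x = label b R ω y :=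
  label_eq_of_reflTransGen hd hb hR hC (hCconn x hx y hy)

end Good

/-! ### Internal sites of a ball are joined inside the ball by nearest-neighbour chains of internal sites -/

section BoxChain

variable {b R : ℕ}

/-- A unit step in a coordinate is a nearest-neighbour bond. [cite: FriedliVelenik2017, §3.1] -/
theorem adj_update_add (x : Site d) (i : Fin d) {ε : ℤ} (hε : ε = 1 ∨ ε = -1) :
    (zdGraph d).Adj x (Function.update x i (x i + ε)) := by
  have h : Function.update x i (x i + ε) = x + ε • (Pi.single i (1 : ℤ) : Site d) := by
    funext k
    rw [add_zsmul_single_apply]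
    by_cases hk : k = i
    · subst hk; simp
    · simp [hk]
  rw [h]
  exact zdGraph_adj_add_zsmul_single x i hε

/-- A site with a coordinate one off a coordinate of an image site is internal (`b ≥ 2`).
[cite: VanenterFernandezSokal1993, §3.1.2 eq. (3.7)] -/
theorem not_isSpImageSite_of_apply_eq (hb : 2 ≤ b) {x a : Site d} (ha : IsSpImageSite d b a) {i : Fin d}
    {ε : ℤ} (hε : ε = 1 ∨ ε = -1) (hx : x i = a i + ε) : ¬ IsSpImageSite d b x := by
  intro hx'
  have h1 : (b : ℤ) ∣ ε := by
    have := dvd_sub (hx' i) (ha i)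
    rwa [hx, add_sub_cancel_left] at this
  rcases hε with rfl | rfl
  · have := Int.le_of_dvd one_pos h1; omega
  · have := Int.le_of_dvd one_pos (dvd_neg.2 h1); omega

/-- Bookkeeping: the `ℓ¹`-distance after changing one coordinate. [folklore] -/
theorem sum_natAbs_update (v w : Site d) (i : Fin d) (c : ℤ) :
    ∑ k, (Function.update v i c k - w k).natAbs + (v i - w i).natAbs =
      ∑ k, (v k - w k).natAbs + (c - w i).natAbs := by
  have h1 : (fun k => (Function.update v i c k - w k).natAbs) =
      Function.update (fun k => (v k - w k).natAbs) i (c - w i).natAbs := by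
    funext k
    by_cases hk : k = i
    · subst hk; simp
    · simp [hk]
  have h2 := Finset.sum_update_of_mem (mem_univ i) (fun k => (v k - w k).natAbs) (c - w i).natAbs
  have h3 := Finset.sum_update_of_mem (mem_univ i) (fun k => (v k - w k).natAbs) (v i - w i).natAbs
  rw [Function.update_eq_self] at h3
  rw [h1, h2, h3]
  ring

/-- In dimension `d ≥ 2` there is a second coordinate. [folklore] -/
theorem exists_fin_ne (hd : 2 ≤ d) (i : Fin d) : ∃ j : Fin d, j ≠ i := by
  by_cases hi : i.val = 0
  · exact ⟨⟨1, by omega⟩, fun h => by have := congrArg Fin.val h; simp at this; omega⟩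
  · exact ⟨⟨0, by omega⟩, fun h => by have := congrArg Fin.val h; simp at this; omega⟩

variable (b R) in
/-- The nearest-neighbour relation among the internal sites of `ball R u`. [folklore] -/
def ballRel (u : Site d) (x y : Site d) : Prop :=
  (zdGraph d).Adj x y ∧ (x ∈ ball R u ∧ ¬ IsSpImageSite d b x) ∧ (y ∈ ball R u ∧ ¬ IsSpImageSite d b y)

/-- **Internal sites of a ball are joined inside the ball by nearest-neighbour chains of internal
sites** (`d ≥ 2`, `b ≥ 2`, `R ≥ 1`): walk towards the target coordinate by coordinate; an image
site on the way is bypassed through the neighbouring internal sites one step aside, or around a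
corner. [folklore] -/
theorem boxChain (hd : 2 ≤ d) (hb : 2 ≤ b) (hR : 1 ≤ R) (u : Site d) (n : ℕ) :
    ∀ v w : Site d, ∑ k, (v k - w k).natAbs ≤ n → v ∈ ball R u → w ∈ ball R u →
      ¬ IsSpImageSite d b v → ¬ IsSpImageSite d b w → ReflTransGen (ballRel b R u) v w := by
  induction n using Nat.strong_induction_on with
  | _ n ih =>
  intro v w hn hv hw hvi hwi
  have hvc := mem_ball.1 hv
  have hwc := mem_ball.1 hw
  by_cases h0 : ∑ k, (v k - w k).natAbs = 0
  · have : v = w := funext fun k => by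
      have := (Finset.sum_eq_zero_iff.1 h0) k (mem_univ k); omega
    subst this
    exact ReflTransGen.refl
  -- a coordinate where `v` and `w` differ, and the unit step towards `w`
  obtain ⟨i, hi⟩ : ∃ i, v i ≠ w i := by
    by_contra hcon
    push Not at hcon
    exact h0 (Finset.sum_eq_zero fun k _ => by rw [hcon k]; simp)
  set ε : ℤ := if v i < w i then 1 else -1 with hε
  have hε1 : ε = 1 ∨ ε = -1 := by by_cases h : v i < w i <;> simp [hε, h]
  have hεw : (v i + ε - w i).natAbs + 1 = (v i - w i).natAbs := by
    by_cases h : v i < w i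
    · simp only [hε, h, if_true]; omega
    · simp only [hε, h, if_false]; omega
  set p : Site d := Function.update v i (v i + ε) with hp
  have hp_i : p i = v i + ε := by simp [hp]
  have hp_ne : ∀ k, k ≠ i → p k = v k := fun k hk => by simp [hp, hk]
  have hp_ball : p ∈ ball R u := mem_ball.2 fun k => by
    by_cases hk : k = i
    · subst hk; rw [hp_i]; have := hvc k; have := hwc k
      by_cases h : v k < w k
      · simp only [hε, h, if_true]; omega
      · simp only [hε, h, if_false]; omega
    · rw [hp_ne k hk]; exact hvc k
  have hadj_vp : (zdGraph d).Adj v p := adj_update_add v i hε1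
  have hsum_p : ∑ k, (p k - w k).natAbs + 1 = ∑ k, (v k - w k).natAbs := by
    have := sum_natAbs_update v w i (v i + ε)
    rw [← hp] at this
    omega
  by_cases hpi : ¬ IsSpImageSite d b p
  · -- ordinary step
    exact ReflTransGen.head ⟨hadj_vp, ⟨hv, hvi⟩, hp_ball, hpi⟩
      (ih (n - 1) (by omega) p w (by omega) hp_ball hw hpi hwi)
  push Not at hpi
  -- `p` is an image site: bypass it
  obtain ⟨j, hji⟩ := exists_fin_ne hd i
  by_cases h2 : 2 ≤ (v i - w i).natAbs
  · -- go straight through: `v → v+δeⱼ → p+δeⱼ → q+δeⱼ → q`, `q = v + 2εeᵢ`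
    set δ : ℤ := if v j < u j + R then 1 else -1 with hδ
    have hδ1 : δ = 1 ∨ δ = -1 := by by_cases h : v j < u j + R <;> simp [hδ, h]
    have hδrange : (u j - (v j + δ)).natAbs ≤ R := by
      have := hvc j
      by_cases h : v j < u j + R
      · simp only [hδ, h, if_true]; omega
      · simp only [hδ, h, if_false]; omega
    set q : Site d := Function.update v i (v i + 2 * ε) with hq
    set v₁ : Site d := Function.update v j (v j + δ) with hv₁
    set v₂ : Site d := Function.update v₁ i (v i + ε) with hv₂
    set v₃ : Site d := Function.update v₂ i (v i + 2 * ε) with hv₃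
    have hq_i : q i = v i + 2 * ε := by simp [hq]
    have hq_ne : ∀ k, k ≠ i → q k = v k := fun k hk => by simp [hq, hk]
    have hv₁_j : v₁ j = v j + δ := by simp [hv₁]
    have hv₁_ne : ∀ k, k ≠ j → v₁ k = v k := fun k hk => by simp [hv₁, hk]
    have hv₂_i : v₂ i = v i + ε := by simp [hv₂]
    have hv₂_ne : ∀ k, k ≠ i → v₂ k = v₁ k := fun k hk => by simp [hv₂, hk]
    have hv₃_i : v₃ i = v i + 2 * ε := by simp [hv₃]
    have hv₃_ne : ∀ k, k ≠ i → v₃ k = v₂ k := fun k hk => by simp [hv₃, hk]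
    -- internal: coordinate `j` is one off the image site `p`, resp. coordinate `i` for `q`
    have hpj : p j = v j := hp_ne j hji
    have hv₁int : ¬ IsSpImageSite d b v₁ :=
      not_isSpImageSite_of_apply_eq hb hpi hδ1 (by rw [hv₁_j, hpj])
    have hv₂int : ¬ IsSpImageSite d b v₂ :=
      not_isSpImageSite_of_apply_eq hb hpi hδ1 (by rw [hv₂_ne j hji, hv₁_j, hpj])
    have hv₃int : ¬ IsSpImageSite d b v₃ :=
      not_isSpImageSite_of_apply_eq hb hpi hδ1 (by rw [hv₃_ne j hji, hv₂_ne j hji, hv₁_j, hpj])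
    have hqint : ¬ IsSpImageSite d b q :=
      not_isSpImageSite_of_apply_eq hb hpi hε1 (by rw [hq_i, hp_i]; ring)
    -- coordinate `i` of `q` stays between `v i` and `w i`
    have hqi_range : (u i - (v i + 2 * ε)).natAbs ≤ R ∧ (v i + 2 * ε - w i).natAbs + 2 = (v i - w i).natAbs := by
      have := hvc i; have := hwc i
      by_cases h : v i < w i
      · simp only [hε, h, if_true]; omega
      · simp only [hε, h, if_false]; omega
    have hpi_range : (u i - (v i + ε)).natAbs ≤ R := by rw [← hp_i]; exact mem_ball.1 hp_ball i
    -- ball membership of the four new points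
    have hq_ball : q ∈ ball R u := mem_ball.2 fun k => by
      by_cases hk : k = i
      · subst hk; rw [hq_i]; exact hqi_range.1
      · rw [hq_ne k hk]; exact hvc k
    have hv₁_ball : v₁ ∈ ball R u := mem_ball.2 fun k => by
      by_cases hk : k = j
      · subst hk; rw [hv₁_j]; exact hδrange
      · rw [hv₁_ne k hk]; exact hvc k
    have hv₁c := mem_ball.1 hv₁_ball
    have hv₂_ball : v₂ ∈ ball R u := mem_ball.2 fun k => by
      by_cases hk : k = i
      · subst hk; rw [hv₂_i]; exact hpi_range
      · rw [hv₂_ne k hk]; exact hv₁c k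
    have hv₂c := mem_ball.1 hv₂_ball
    have hv₃_ball : v₃ ∈ ball R u := mem_ball.2 fun k => by
      by_cases hk : k = i
      · subst hk; rw [hv₃_i]; exact hqi_range.1
      · rw [hv₃_ne k hk]; exact hv₂c k
    -- the four bonds
    have ha₁ : (zdGraph d).Adj v v₁ := adj_update_add v j hδ1
    have ha₂ : (zdGraph d).Adj v₁ v₂ := by
      have := adj_update_add v₁ i hε1
      rwa [hv₁_ne i hji.symm] at this
    have ha₃ : (zdGraph d).Adj v₂ v₃ := by
      have := adj_update_add v₂ i hε1
      rw [hv₂_i, show v i + ε + ε = v i + 2 * ε by ring] at this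
      exact this
    have hv₃_eq : v₃ = Function.update q j (v j + δ) := by
      funext k
      by_cases hki : k = i
      · subst hki
        rw [hv₃_i, Function.update_of_ne hji.symm, hq_i]
      · rw [hv₃_ne k hki, hv₂_ne k hki]
        by_cases hkj : k = j
        · subst hkj; rw [hv₁_j, Function.update_self]
        · rw [hv₁_ne k hkj, Function.update_of_ne hkj, hq_ne k hki]
    have ha₄ : (zdGraph d).Adj v₃ q := by
      have := adj_update_add q j hδ1
      rw [hq_ne j hji] at this
      rw [hv₃_eq]
      exact this.symm
    have hsum_q : ∑ k, (q k - w k).natAbs + 2 = ∑ k, (v k - w k).natAbs := by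
      have := sum_natAbs_update v w i (v i + 2 * ε)
      rw [← hq] at this
      omega
    refine ReflTransGen.head ⟨ha₁, ⟨hv, hvi⟩, hv₁_ball, hv₁int⟩
      (ReflTransGen.head ⟨ha₂, ⟨hv₁_ball, hv₁int⟩, hv₂_ball, hv₂int⟩
        (ReflTransGen.head ⟨ha₃, ⟨hv₂_ball, hv₂int⟩, hv₃_ball, hv₃int⟩
          (ReflTransGen.head ⟨ha₄, ⟨hv₃_ball, hv₃int⟩, hq_ball, hqint⟩
            (ih (n - 2) (by omega) q w (by omega) hq_ball hw hqint hwi))))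
  · -- `|v i - w i| = 1`: `p i = w i`; turn at the corner towards `w` in a coordinate `j'` where
    -- `p` and `w` differ
    have h1 : (v i - w i).natAbs = 1 := by omega
    have hpw_i : p i = w i := by rw [hp_i]; omega
    obtain ⟨j', hj'⟩ : ∃ j', p j' ≠ w j' := by
      by_contra hcon
      push Not at hcon
      exact hwi (funext hcon ▸ hpi)
    have hj'i : j' ≠ i := fun h => hj' (h ▸ hpw_i)
    have hvj' : v j' = p j' := (hp_ne j' hj'i).symm
    set δ : ℤ := if p j' < w j' then 1 else -1 with hδ
    have hδ1 : δ = 1 ∨ δ = -1 := by by_cases h : p j' < w j' <;> simp [hδ, h]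
    have hδw : (v j' + δ - w j').natAbs + 1 = (v j' - w j').natAbs ∧ (u j' - (v j' + δ)).natAbs ≤ R := by
      have := hvc j'; have := hwc j'
      rw [hvj']
      by_cases h : p j' < w j'
      · simp only [hδ, h, if_true]; omega
      · simp only [hδ, h, if_false]; omega
    set v₁ : Site d := Function.update v j' (v j' + δ) with hv₁
    set q : Site d := Function.update v₁ i (v i + ε) with hq
    have hv₁_j : v₁ j' = v j' + δ := by simp [hv₁]
    have hv₁_ne : ∀ k, k ≠ j' → v₁ k = v k := fun k hk => by simp [hv₁, hk]
    have hq_i : q i = v i + ε := by simp [hq]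
    have hq_ne : ∀ k, k ≠ i → q k = v₁ k := fun k hk => by simp [hq, hk]
    have hv₁int : ¬ IsSpImageSite d b v₁ :=
      not_isSpImageSite_of_apply_eq hb hpi hδ1 (by rw [hv₁_j, hvj'])
    have hqint : ¬ IsSpImageSite d b q :=
      not_isSpImageSite_of_apply_eq hb hpi hδ1 (by rw [hq_ne j' hj'i, hv₁_j, hvj'])
    have hpi_range : (u i - (v i + ε)).natAbs ≤ R := by rw [← hp_i]; exact mem_ball.1 hp_ball i
    have hv₁_ball : v₁ ∈ ball R u := mem_ball.2 fun k => by
      by_cases hk : k = j'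
      · subst hk; rw [hv₁_j]; exact hδw.2
      · rw [hv₁_ne k hk]; exact hvc k
    have hv₁c := mem_ball.1 hv₁_ball
    have hq_ball : q ∈ ball R u := mem_ball.2 fun k => by
      by_cases hk : k = i
      · subst hk; rw [hq_i]; exact hpi_range
      · rw [hq_ne k hk]; exact hv₁c k
    have ha₁ : (zdGraph d).Adj v v₁ := adj_update_add v j' hδ1
    have ha₂ : (zdGraph d).Adj v₁ q := by
      have := adj_update_add v₁ i hε1
      rwa [hv₁_ne i hj'i.symm] at this
    have hsum_q : ∑ k, (q k - w k).natAbs + 2 = ∑ k, (v k - w k).natAbs := by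
      have e1 := sum_natAbs_update v w j' (v j' + δ)
      have e2 := sum_natAbs_update v₁ w i (v i + ε)
      rw [hv₁_ne i hj'i.symm] at e2
      rw [← hq] at e2
      rw [← hv₁] at e1
      omega
    exact ReflTransGen.head ⟨ha₁, ⟨hv, hvi⟩, hv₁_ball, hv₁int⟩
      (ReflTransGen.head ⟨ha₂, ⟨hv₁_ball, hv₁int⟩, hq_ball, hqint⟩
        (ih (n - 2) (by omega) q w (by omega) hq_ball hw hqint hwi))

/-- A chain whose endpoints carry different values of `f` has a step across which `f` changes.
[folklore] -/
theorem exists_step_ne {α β : Type*} {r : α → α → Prop} {f : α → β} {x y : α}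
    (h : ReflTransGen r x y) (hne : f x ≠ f y) : ∃ a c, r a c ∧ f a ≠ f c := by
  induction h with
  | refl => exact absurd rfl hne
  | @tail b' c _ hbc ih =>
    by_cases hb' : f x = f b'
    · exact ⟨b', c, hbc, fun h => hne (hb'.trans h)⟩
    · exact ih hb'

/-- **A bad site has a disagreeing nearest-neighbour bond of internal sites inside its ball**
(`d ≥ 2`, `b ≥ 2`, `R ≥ 1`). [cite: FriedliVelenik2017, §7.2.1] -/
theorem exists_adj_ne_of_not_isGood (hd : 2 ≤ d) (hb : 2 ≤ b) (hR : 1 ≤ R) {ω : SpinConfig (Site d)}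
    {u : Site d} (h : ¬ IsGood b R ω u) :
    ∃ x y, (zdGraph d).Adj x y ∧ x ∈ ball R u ∧ y ∈ ball R u ∧ ¬ IsSpImageSite d b x ∧
      ¬ IsSpImageSite d b y ∧ ω x ≠ ω y := by
  unfold IsGood at h
  push Not at h
  obtain ⟨v, hv, w, hw, hvi, hwi, hne⟩ := h
  have hchain := boxChain hd hb hR u _ v w le_rfl hv hw hvi hwi
  obtain ⟨x, y, hxy, hne'⟩ := exists_step_ne (f := ω) hchain hne
  exact ⟨x, y, hxy.1, hxy.2.1.1, hxy.2.2.1, hxy.2.1.2, hxy.2.2.2, hne'⟩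

end BoxChain

/-! ### Contours: `★`-components of the bad set; collars; typing -/

section Contours

variable (b R : ℕ)

/-- **`γ` is a contour of the configuration `ω`**: a non-empty `★`-connected set of bad sites that is
a full `★`-component of the bad set (every `★`-neighbour of `γ` outside `γ` is good) — the thick
contours `γ̄` of Friedli–Velenik, here for the internal-spin system of van Enter–Fernández–Sokal.
[cite: FriedliVelenik2017, §7.2.6 (contours as maximal connected components of the bad set)] -/
structure IsContourOf (ω : SpinConfig (Site d)) (γ : Finset (Site d)) : Prop where
  /-- a contour is non-empty -/
  nonempty : γ.Nonempty
  /-- a contour is `★`-connected -/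
  starConn : StarConn (γ : Set (Site d))
  /-- its sites are bad -/
  bad : ∀ g ∈ γ, ¬ IsGood b R ω g
  /-- it is a whole `★`-component of the bad set -/
  maximal : ∀ g ∈ γ, ∀ y, (zdStar d).Adj g y → y ∉ γ → IsGood b R ω y

/-- **The exterior label** of a contour: the common label of its exterior collar
`∂^ex(hull γ)` (`label_eq_extLabel`) — the type of the contour. [cite: FriedliVelenik2017, §7.2.6 (type of a contour)] -/
def extLabel (ω : SpinConfig (Site d)) (γ : Finset (Site d)) : ℤˣ :=
  open Classical in
  if ∃ c ∈ exBoundary (starHullFinset γ), label b R ω c = 1 then 1 else -1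

/-- **The label of an interior component** `A`: the common label of its collar `∂^in A`
(`label_eq_compLabel`). [cite: FriedliVelenik2017, §7.2.6 (labels of the interior components)] -/
def compLabel (ω : SpinConfig (Site d)) (A : Finset (Site d)) : ℤˣ :=
  open Classical in
  if ∃ c ∈ inBoundary A, label b R ω c = 1 then 1 else -1

variable {b R}

/-- A site of the exterior collar is `★`-adjacent to the contour (not only to its hull) and lies in
the exterior. [cite: FriedliVelenik2017, §7.2.6] -/
theorem exists_adj_of_mem_exBoundary_hull (hd : 2 ≤ d) {γ : Finset (Site d)} {c : Site d}
    (hc : c ∈ exBoundary (starHullFinset γ)) : c ∈ starExt γ ∧ ∃ g ∈ γ, (zdStar d).Adj g c := by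
  obtain ⟨hch, x, hx, hxc⟩ := mem_exBoundary.1 hc
  rw [mem_starHullFinset hd] at hch hx
  have hce : c ∈ starExt γ := by
    by_contra h; exact hch h
  refine ⟨hce, ?_⟩
  by_cases hxγ : x ∈ γ
  · exact ⟨x, hxγ, hxc⟩
  · exfalso
    have hxe : x ∈ starExt γ :=
      mem_starExt_of_reflTransGen hce (ReflTransGen.single ⟨hxc.symm, not_mem_of_mem_starExt hce, hxγ⟩)
    exact hx hxe

/-- A site of the collar of an interior component is `★`-adjacent to the contour.
[cite: FriedliVelenik2017, §7.2.6] -/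
theorem exists_adj_of_mem_inBoundary_comp (hd : 2 ≤ d) {γ : Finset (Site d)} {x : Site d}
    (hx : x ∈ starInt γ) {c : Site d} (hc : c ∈ inBoundary (starIntComp γ x)) :
    c ∉ γ ∧ ∃ g ∈ γ, (zdStar d).Adj g c := by
  obtain ⟨hcA, y, hyA, hcy⟩ := mem_inBoundary.1 hc
  have hcγ : c ∉ γ := ((mem_starInt hd).1 (starIntComp_subset γ x hcA)).1
  refine ⟨hcγ, ?_⟩
  by_cases hyγ : y ∈ γ
  · exact ⟨y, hyγ, hcy.symm⟩
  · exact absurd (mem_starIntComp_of_starRel hd hx hcA ⟨hcy, hcγ, hyγ⟩) hyA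

/-- Sites of the exterior collar of a contour are good. [cite: FriedliVelenik2017, §7.2.6, Lemma 7.19] -/
theorem isGood_of_mem_exBoundary_hull (hd : 2 ≤ d) {ω : SpinConfig (Site d)} {γ : Finset (Site d)}
    (hγ : IsContourOf b R ω γ) {c : Site d} (hc : c ∈ exBoundary (starHullFinset γ)) : IsGood b R ω c := by
  obtain ⟨hce, g, hg, hgc⟩ := exists_adj_of_mem_exBoundary_hull hd hc
  exact hγ.maximal g hg c hgc (not_mem_of_mem_starExt hce)

/-- Sites of the collar of an interior component of a contour are good.
[cite: FriedliVelenik2017, §7.2.6, Lemma 7.19] -/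
theorem isGood_of_mem_inBoundary_comp (hd : 2 ≤ d) {ω : SpinConfig (Site d)} {γ : Finset (Site d)}
    (hγ : IsContourOf b R ω γ) {x : Site d} (hx : x ∈ starInt γ) {c : Site d}
    (hc : c ∈ inBoundary (starIntComp γ x)) : IsGood b R ω c := by
  obtain ⟨hcγ, g, hg, hgc⟩ := exists_adj_of_mem_inBoundary_comp hd hx hc
  exact hγ.maximal g hg c hgc hcγ

/-- **Typing, exterior** (Friedli–Velenik Lemma 7.19): the label is constant on the exterior collar
of a contour, equal to `extLabel`. [cite: FriedliVelenik2017, §7.2.6, Lemma 7.19] -/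
theorem label_eq_extLabel (hd : 2 ≤ d) (hb : 2 ≤ b) (hR : 2 ≤ R) {ω : SpinConfig (Site d)}
    {γ : Finset (Site d)} (hγ : IsContourOf b R ω γ) {c : Site d} (hc : c ∈ exBoundary (starHullFinset γ)) :
    label b R ω c = extLabel b R ω γ := by
  classical
  have hconn := (starConn_boundaries_starHull hd hγ.starConn).1
  have hgood : ∀ c' ∈ (exBoundary (starHullFinset γ) : Set (Site d)), IsGood b R ω c' :=
    fun c' hc' => isGood_of_mem_exBoundary_hull hd hγ (mem_coe.1 hc')
  unfold extLabel
  split_ifs with h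
  · obtain ⟨c', hc', h1⟩ := h
    rw [← h1]
    exact label_eq_of_starConn (by omega) hb hR hconn hgood (mem_coe.2 hc) (mem_coe.2 hc')
  · push Not at h
    rcases Int.units_eq_one_or (label b R ω c) with h1 | h1
    · exact absurd h1 (h c hc)
    · exact h1

/-- **Typing, interior** (Friedli–Velenik Lemma 7.19): the label is constant on the collar of each
interior component of a contour, equal to `compLabel`. [cite: FriedliVelenik2017, §7.2.6, Lemma 7.19] -/
theorem label_eq_compLabel (hd : 2 ≤ d) (hb : 2 ≤ b) (hR : 2 ≤ R) {ω : SpinConfig (Site d)}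
    {γ : Finset (Site d)} (hγ : IsContourOf b R ω γ) {x : Site d} (hx : x ∈ starInt γ) {c : Site d}
    (hc : c ∈ inBoundary (starIntComp γ x)) : label b R ω c = compLabel b R ω (starIntComp γ x) := by
  classical
  have hconn := (starConn_boundaries_starIntComp hd hγ.starConn hx).1
  have hgood : ∀ c' ∈ (inBoundary (starIntComp γ x) : Set (Site d)), IsGood b R ω c' :=
    fun c' hc' => isGood_of_mem_inBoundary_comp hd hγ hx (mem_coe.1 hc')
  unfold compLabel
  split_ifs with h
  · obtain ⟨c', hc', h1⟩ := h
    rw [← h1]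
    exact label_eq_of_starConn (by omega) hb hR hconn hgood (mem_coe.2 hc) (mem_coe.2 hc')
  · push Not at h
    rcases Int.units_eq_one_or (label b R ω c) with h1 | h1
    · exact absurd h1 (h c hc)
    · exact h1

/-- The component label only depends on the component. [folklore] -/
theorem compLabel_congr {ω : SpinConfig (Site d)} {A A' : Finset (Site d)} (h : A = A') :
    compLabel b R ω A = compLabel b R ω A' := by rw [h]

/-! ### Near the contour every spin off the contour is the label of its component -/

/-- **Collar sites are within reach**: a site off the contour at sup-distance `≤ n` from a site of
the contour has, within sup-distance `n`, a site of the exterior collar (if it is exterior) or of the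
collar of its interior component (if it is interior) — follow a `d_∞`-geodesic towards the contour.
[cite: FriedliVelenik2017, §7.2.6] -/
theorem exists_collar_near (hd : 2 ≤ d) {γ : Finset (Site d)} {g : Site d} (hg : g ∈ γ) (n : ℕ) :
    ∀ y : Site d, y ∉ γ → supDist g y ≤ n →
      (y ∈ starExt γ → ∃ c ∈ exBoundary (starHullFinset γ), y ∈ ball n c) ∧
      (y ∈ starInt γ → ∃ c ∈ inBoundary (starIntComp γ y), y ∈ ball n c) := by
  induction n with
  | zero =>
    intro y hy hdist
    exact absurd (eq_of_supDist_eq_zero (Nat.le_zero.1 hdist) ▸ hg) hy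
  | succ n ih =>
    intro y hy hdist
    obtain ⟨z, hgz, hzy⟩ := exists_clamp n hdist
    by_cases hzy' : z = y
    · subst hzy'
      exact ⟨fun he => (ih z hy hgz).1 he |>.imp fun c hc => ⟨hc.1, ball_mono (Nat.le_succ n) c hc.2⟩,
        fun hi => (ih z hy hgz).2 hi |>.imp fun c hc => ⟨hc.1, ball_mono (Nat.le_succ n) c hc.2⟩⟩
    have hadj : (zdStar d).Adj y z := zdStar_adj.2 ⟨fun h => hzy' h.symm, by rwa [supDist_comm]⟩
    by_cases hzγ : z ∈ γ
    · -- `y` itself is a collar site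
      refine ⟨fun he => ⟨y, ?_, mem_ball_self _ _⟩, fun hi => ⟨y, ?_, mem_ball_self _ _⟩⟩
      · refine mem_exBoundary.2 ⟨fun h => ((mem_starHullFinset hd).1 h) he, z, ?_, hadj.symm⟩
        exact (mem_starHullFinset hd).2 (subset_starHull γ (mem_coe.2 hzγ))
      · exact mem_inBoundary.2 ⟨mem_starIntComp_self hd hi, z,
          fun h => ((mem_starInt hd).1 (starIntComp_subset γ y h)).1 hzγ, hadj⟩
    · -- step to `z`, in the same component
      have hstep : starRel (γ : Set (Site d))ᶜ y z := ⟨hadj, hy, hzγ⟩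
      obtain ⟨ihe, ihi⟩ := ih z hzγ hgz
      refine ⟨fun he => ?_, fun hi => ?_⟩
      · obtain ⟨c, hc, hzc⟩ := ihe (mem_starExt_of_reflTransGen he (ReflTransGen.single hstep))
        refine ⟨c, hc, ?_⟩
        have := mem_ball_add hzc (mem_ball_of_adj (le_refl 1) hadj.symm)
        exact this
      · have hzi : z ∈ starInt γ := mem_starInt_of_reflTransGen hd hi (ReflTransGen.single hstep)
        obtain ⟨c, hc, hzc⟩ := ihi hzi
        have hcomp : starIntComp γ z = starIntComp γ y :=
          starIntComp_eq_of_mem hd hi (mem_starIntComp_of_starRel hd hi (mem_starIntComp_self hd hi) hstep)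
        refine ⟨c, hcomp ▸ hc, ?_⟩
        exact mem_ball_add hzc (mem_ball_of_adj (le_refl 1) hadj.symm)

/-- **NEAR, exterior**: an internal spin of the exterior within sup-distance `R` of the contour is
the exterior label. [cite: FriedliVelenik2017, §7.2.6, Lemma 7.19] -/
theorem apply_eq_extLabel_of_near (hd : 2 ≤ d) (hb : 2 ≤ b) (hR : 2 ≤ R) {ω : SpinConfig (Site d)}
    {γ : Finset (Site d)} (hγ : IsContourOf b R ω γ) {g y : Site d} (hg : g ∈ γ) (hye : y ∈ starExt γ)
    (hdist : supDist g y ≤ R) (hyi : ¬ IsSpImageSite d b y) : ω y = extLabel b R ω γ := by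
  obtain ⟨c, hc, hyc⟩ := (exists_collar_near hd hg R y (not_mem_of_mem_starExt hye) hdist).1 hye
  rw [label_spec (isGood_of_mem_exBoundary_hull hd hγ hc) hyc hyi, label_eq_extLabel hd hb hR hγ hc]

/-- **NEAR, interior**: an internal spin of the interior within sup-distance `R` of the contour is
the label of its interior component. [cite: FriedliVelenik2017, §7.2.6, Lemma 7.19] -/
theorem apply_eq_compLabel_of_near (hd : 2 ≤ d) (hb : 2 ≤ b) (hR : 2 ≤ R) {ω : SpinConfig (Site d)}
    {γ : Finset (Site d)} (hγ : IsContourOf b R ω γ) {g y : Site d} (hg : g ∈ γ) (hyi' : y ∈ starInt γ)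
    (hdist : supDist g y ≤ R) (hyi : ¬ IsSpImageSite d b y) :
    ω y = compLabel b R ω (starIntComp γ y) := by
  obtain ⟨c, hc, hyc⟩ :=
    (exists_collar_near hd hg R y ((mem_starInt hd).1 hyi').1 hdist).2 hyi'
  rw [label_spec (isGood_of_mem_inBoundary_comp hd hγ hyi' hc) hyc hyi, label_eq_compLabel hd hb hR hγ hyi' hc]

/-- **Collar spins**: an internal spin of the ball of a collar site of an interior component is the
component label. [cite: FriedliVelenik2017, §7.2.6, Lemma 7.19] -/
theorem apply_eq_compLabel_of_mem_ball_inBoundary (hd : 2 ≤ d) (hb : 2 ≤ b) (hR : 2 ≤ R)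
    {ω : SpinConfig (Site d)} {γ : Finset (Site d)} (hγ : IsContourOf b R ω γ) {x : Site d}
    (hx : x ∈ starInt γ) {c : Site d} (hc : c ∈ inBoundary (starIntComp γ x)) {v : Site d}
    (hv : v ∈ ball R c) (hvi : ¬ IsSpImageSite d b v) : ω v = compLabel b R ω (starIntComp γ x) := by
  rw [label_spec (isGood_of_mem_inBoundary_comp hd hγ hx hc) hv hvi, label_eq_compLabel hd hb hR hγ hx hc]

/-- **Collar spins, exterior**: an internal spin of the ball of an exterior collar site is the
exterior label. [cite: FriedliVelenik2017, §7.2.6, Lemma 7.19] -/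
theorem apply_eq_extLabel_of_mem_ball_exBoundary (hd : 2 ≤ d) (hb : 2 ≤ b) (hR : 2 ≤ R)
    {ω : SpinConfig (Site d)} {γ : Finset (Site d)} (hγ : IsContourOf b R ω γ) {c : Site d}
    (hc : c ∈ exBoundary (starHullFinset γ)) {v : Site d} (hv : v ∈ ball R c) (hvi : ¬ IsSpImageSite d b v) :
    ω v = extLabel b R ω γ := by
  rw [label_spec (isGood_of_mem_exBoundary_hull hd hγ hc) hv hvi, label_eq_extLabel hd hb hR hγ hc]

end Contours

/-! ### Rays: last and first points of a contour along a coordinate half-line -/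

section Rays

/-- A chain along a coordinate ray (in either direction) inside a set. [folklore] -/
theorem reflTransGen_update_ray {T : Set (Site d)} (x : Site d) (k : Fin d) {ε : ℤ} (hε : ε = 1 ∨ ε = -1)
    (n : ℕ) (h : ∀ m : ℕ, m ≤ n → Function.update x k (x k + m * ε) ∈ T) :
    ReflTransGen (starRel T) x (Function.update x k (x k + n * ε)) := by
  rcases hε with rfl | rfl
  · simp only [mul_one] at h ⊢
    exact reflTransGen_update_add x k n h
  · simp only [mul_neg, mul_one, ← sub_eq_add_neg] at h ⊢
    exact reflTransGen_update_sub x k n h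

/-- The point `t` steps along the ray from the point `s` steps along the ray. [folklore] -/
theorem update_ray_add (x : Site d) (k : Fin d) (ε : ℤ) (s t : ℕ) :
    Function.update (Function.update x k (x k + s * ε)) k
        ((Function.update x k (x k + s * ε)) k + t * ε) =
      Function.update x k (x k + (s + t : ℕ) * ε) := by
  rw [Function.update_idem, Function.update_self]
  congr 1
  push_cast
  ring

/-- Far along a coordinate ray every point is exterior to a finite set. [folklore] -/
theorem exists_ray_mem_starExt (hd : 2 ≤ d) (γ : Finset (Site d)) (y : Site d) (i : Fin d) {ε : ℤ}
    (hε : ε = 1 ∨ ε = -1) : ∃ T : ℕ, Function.update y i (y i + T * ε) ∈ starExt γ := by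
  set L := boxRadius γ
  have hγ : γ ⊆ box d L := subset_box_boxRadius γ
  refine ⟨L + (y i).natAbs + 1, ?_⟩
  rcases hε with rfl | rfl
  · refine mem_starExt_of_forall_lt hd i fun x hx => ?_
    have := (mem_box.1 (hγ hx)) i
    rw [Function.update_self, mul_one]
    omega
  · refine mem_starExt_of_forall_gt hd i fun x hx => ?_
    have := (mem_box.1 (hγ hx)) i
    rw [Function.update_self, mul_neg_one]
    omega

/-- **Last contour point on a ray**: from a point of the hull of `γ`, along any coordinate ray there
is a point of `γ` whose successor on the ray lies in the exterior collar `∂^ex(hull γ)`.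
[cite: FriedliVelenik2017, §7.2.6] -/
theorem exists_last_on_ray (hd : 2 ≤ d) {γ : Finset (Site d)} {y : Site d} (hy : y ∉ starExt γ) (i : Fin d)
    {ε : ℤ} (hε : ε = 1 ∨ ε = -1) :
    ∃ t : ℕ, Function.update y i (y i + t * ε) ∈ γ ∧
      Function.update y i (y i + (t + 1 : ℕ) * ε) ∈ exBoundary (starHullFinset γ) := by
  classical
  obtain ⟨T, hT⟩ := exists_ray_mem_starExt hd γ y i hε
  set pt : ℕ → Site d := fun t => Function.update y i (y i + t * ε) with hpt
  set H : Finset ℕ := (Finset.range (T + 1)).filter fun t => pt t ∈ γ with hH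
  -- the ray meets `γ` before `T`
  have hHne : H.Nonempty := by
    by_contra hcon
    rw [not_nonempty_iff_eq_empty] at hcon
    have hall : ∀ m : ℕ, m ≤ T → pt m ∈ (γ : Set (Site d))ᶜ := by
      intro m hm hm'
      have : m ∈ H := mem_filter.2 ⟨mem_range.2 (by omega), hm'⟩
      rw [hcon] at this
      exact notMem_empty m this
    have hchain := reflTransGen_update_ray (T := (γ : Set (Site d))ᶜ) y i hε T hall
    exact hy (mem_starExt_of_reflTransGen hT (reflTransGen_starRel_symm hchain))
  obtain ⟨t₀, ht₀, hmax⟩ := H.exists_max_image id hHne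
  obtain ⟨ht₀T, ht₀γ⟩ := mem_filter.1 ht₀
  rw [mem_range] at ht₀T
  refine ⟨t₀, ht₀γ, ?_⟩
  -- beyond `t₀` the ray avoids `γ`, so `pt (t₀ + 1)` is chained to the exterior point `pt T`
  have hbeyond : ∀ m : ℕ, t₀ < m → m ≤ T → pt m ∉ γ := by
    intro m hm hmT hmγ
    have : m ≤ t₀ := hmax m (mem_filter.2 ⟨mem_range.2 (by omega), hmγ⟩)
    omega
  by_cases ht₀T' : t₀ + 1 ≤ T
  · have hchain : ReflTransGen (starRel (γ : Set (Site d))ᶜ) (pt (t₀ + 1)) (pt T) := by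
      have h := reflTransGen_update_ray (T := (γ : Set (Site d))ᶜ) (pt (t₀ + 1)) i hε (T - (t₀ + 1))
        fun m hm => by
          rw [hpt, update_ray_add]
          exact fun h' => hbeyond _ (by omega) (by omega) h'
      rwa [hpt, update_ray_add, show t₀ + 1 + (T - (t₀ + 1)) = T by omega] at h
    have hext : pt (t₀ + 1) ∈ starExt γ := mem_starExt_of_reflTransGen hT (reflTransGen_starRel_symm hchain)
    refine mem_exBoundary.2 ⟨fun h => ((mem_starHullFinset hd).1 h) hext, pt t₀,
      (mem_starHullFinset hd).2 (subset_starHull γ (mem_coe.2 ht₀γ)), ?_⟩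
    have : pt (t₀ + 1) = Function.update (pt t₀) i ((pt t₀) i + ε) := by
      rw [hpt]; simp only
      rw [Function.update_idem, Function.update_self]; congr 1; push_cast; ring
    change (zdStar d).Adj (pt t₀) (pt (t₀ + 1))
    rw [this]
    exact zdGraph_le_zdStar (adj_update_add _ i hε)
  · -- `t₀ = T`: impossible, `pt T` is exterior
    exfalso
    have : t₀ = T := by omega
    subst this
    exact (not_mem_of_mem_starExt hT) ht₀γ

/-- **First contour point on a ray**: from an interior point of `γ`, along any coordinate ray there is
a first point of `γ`, at a step `t ≥ 1`; all earlier points lie in the interior component of the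
starting point. [cite: FriedliVelenik2017, §7.2.6] -/
theorem exists_first_on_ray (hd : 2 ≤ d) {γ : Finset (Site d)} {y : Site d} (hy : y ∈ starInt γ) (i : Fin d)
    {ε : ℤ} (hε : ε = 1 ∨ ε = -1) :
    ∃ t : ℕ, 1 ≤ t ∧ Function.update y i (y i + t * ε) ∈ γ ∧
      ∀ m : ℕ, m < t → Function.update y i (y i + m * ε) ∈ starIntComp γ y := by
  classical
  obtain ⟨hyγ, hye⟩ := (mem_starInt hd).1 hy
  obtain ⟨T, hT⟩ := exists_ray_mem_starExt hd γ y i hε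
  set pt : ℕ → Site d := fun t => Function.update y i (y i + t * ε) with hpt
  set H : Finset ℕ := (Finset.range (T + 1)).filter fun t => pt t ∈ γ with hH
  have hHne : H.Nonempty := by
    by_contra hcon
    rw [not_nonempty_iff_eq_empty] at hcon
    have hall : ∀ m : ℕ, m ≤ T → pt m ∈ (γ : Set (Site d))ᶜ := by
      intro m hm hm'
      have : m ∈ H := mem_filter.2 ⟨mem_range.2 (by omega), hm'⟩
      rw [hcon] at this
      exact notMem_empty m this
    have hchain := reflTransGen_update_ray (T := (γ : Set (Site d))ᶜ) y i hε T hall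
    exact hye (mem_starExt_of_reflTransGen hT (reflTransGen_starRel_symm hchain))
  obtain ⟨t₁, ht₁, hmin⟩ := H.exists_min_image id hHne
  obtain ⟨-, ht₁γ⟩ := mem_filter.1 ht₁
  have ht₁T : t₁ < T + 1 := mem_range.1 (mem_filter.1 ht₁).1
  have hbefore : ∀ m : ℕ, m < t₁ → pt m ∉ γ := by
    intro m hm hmγ
    have : t₁ ≤ m := hmin m (mem_filter.2 ⟨mem_range.2 (by omega), hmγ⟩)
    omega
  have ht₁pos : 1 ≤ t₁ := by
    by_contra h
    have : t₁ = 0 := by omega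
    subst this
    refine hyγ ?_
    have : pt 0 = y := by rw [hpt]; simp
    rwa [this] at ht₁γ
  refine ⟨t₁, ht₁pos, ht₁γ, fun m hm => ?_⟩
  have hchain : ReflTransGen (starRel (γ : Set (Site d))ᶜ) y (pt m) :=
    reflTransGen_update_ray (T := (γ : Set (Site d))ᶜ) y i hε m fun m' hm' h' => hbefore m' (by omega) h'
  exact (mem_starIntComp hd hy).2 hchain

end Rays

/-! ### The far region is `+`: location of contours and of their oppositely labelled parts -/

section Far

variable {b R : ℕ}

variable (b) in
/-- **All internal spins outside the cube `box d N` are `+`** — the property of the configurations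
of the finite-volume systems with `+` exterior (volume = internal sites of `Λ_{R'} = box d (bR')`,
all spins outside frozen to `+`). [cite: VanenterFernandezSokal1993, §4.3.1 Step 2 (the `+` exterior)] -/
def PlusOutside (N : ℕ) (ω : SpinConfig (Site d)) : Prop :=
  ∀ v, ¬ IsSpImageSite d b v → v ∉ box d N → ω v = 1

/-- A point whose ball sticks out of `box d N` in some coordinate has an internal site of its ball
outside the box (`d ≥ 2`, `b ≥ 2`, `R ≥ 1`). [folklore] -/
theorem exists_internal_mem_ball_not_mem_box (hd : 2 ≤ d) (hb : 2 ≤ b) (hR : 1 ≤ R) {N : ℕ} {u : Site d}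
    {i : Fin d} (hu : N < (u i).natAbs + R) :
    ∃ v ∈ ball R u, ¬ IsSpImageSite d b v ∧ v ∉ box d N := by
  -- push coordinate `i` outwards by `R`
  set ε : ℤ := if 0 ≤ u i then 1 else -1 with hε
  set v₀ : Site d := Function.update u i (u i + R * ε) with hv₀
  have hv₀i : v₀ i = u i + R * ε := by simp [hv₀]
  have hv₀ne : ∀ k, k ≠ i → v₀ k = u k := fun k hk => by simp [hv₀, hk]
  have hfar : ∀ z : Site d, z i = u i + R * ε → z ∉ box d N := by
    intro z hz hzb
    have := (mem_box.1 hzb) i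
    rw [hz] at this
    by_cases h0 : 0 ≤ u i
    · simp only [hε, h0, if_true] at this; omega
    · simp only [hε, h0, if_false] at this; omega
  have hv₀ball : v₀ ∈ ball R u := mem_ball.2 fun k => by
    by_cases hk : k = i
    · subst hk; rw [hv₀i]
      by_cases h0 : 0 ≤ u k
      · simp only [hε, h0, if_true]; omega
      · simp only [hε, h0, if_false]; omega
    · rw [hv₀ne k hk]; simp
  by_cases hv₀img : IsSpImageSite d b v₀
  · -- step once more in another coordinate
    obtain ⟨j, hji⟩ := exists_fin_ne hd i
    refine ⟨Function.update v₀ j (v₀ j + 1), ?_, ?_, hfar _ ?_⟩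
    · refine mem_ball.2 fun k => ?_
      by_cases hkj : k = j
      · subst hkj; rw [Function.update_self, hv₀ne k hji]; omega
      · rw [Function.update_of_ne hkj]; exact mem_ball.1 hv₀ball k
    · exact not_isSpImageSite_of_apply_eq hb hv₀img (Or.inl rfl) (Function.update_self _ _ _)
    · rw [Function.update_of_ne hji.symm, hv₀i]
  · exact ⟨v₀, hv₀ball, hv₀img, hfar v₀ hv₀i⟩

/-- **Good sites whose ball sticks out of the cube are labelled `+`**; in particular far sites.
[cite: VanenterFernandezSokal1993, §4.3.1 Step 2] -/
theorem label_eq_one_of_lt (hd : 2 ≤ d) (hb : 2 ≤ b) (hR : 1 ≤ R) {N : ℕ} {ω : SpinConfig (Site d)}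
    (hω : PlusOutside b N ω) {u : Site d} (hu : IsGood b R ω u) {i : Fin d} (hui : N < (u i).natAbs + R) :
    label b R ω u = 1 := by
  obtain ⟨v, hv, hvi, hvb⟩ := exists_internal_mem_ball_not_mem_box hd hb hR hui
  rw [← label_spec hu hv hvi, hω v hvi hvb]

/-- A good site labelled `-1` lies well inside the cube: all its coordinates satisfy
`|u i| + R ≤ N`. [cite: VanenterFernandezSokal1993, §4.3.1 Step 2] -/
theorem natAbs_add_le_of_label_eq_neg_one (hd : 2 ≤ d) (hb : 2 ≤ b) (hR : 1 ≤ R) {N : ℕ}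
    {ω : SpinConfig (Site d)} (hω : PlusOutside b N ω) {u : Site d} (hu : IsGood b R ω u)
    (hl : label b R ω u = -1) (i : Fin d) : (u i).natAbs + R ≤ N := by
  by_contra h
  have := label_eq_one_of_lt hd hb hR hω hu (i := i) (by omega)
  rw [hl] at this
  exact absurd this (by decide)

/-- **Sites outside `box d (N + R)` are good** (their balls see only `+` internal spins).
[cite: VanenterFernandezSokal1993, §4.3.1 Step 2] -/
theorem isGood_of_not_mem_box (hR : 0 < R ∨ True) {N : ℕ} {ω : SpinConfig (Site d)} (hω : PlusOutside b N ω)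
    {u : Site d} (hu : u ∉ box d (N + R)) : IsGood b R ω u := by
  have _ := hR
  refine isGood_of_forall_eq (s := 1) fun v hv hvi => hω v hvi fun hvb => hu ?_
  rw [mem_box] at hvb ⊢
  intro i
  have := hvb i
  have := mem_ball.1 hv i
  constructor <;> omega

/-- **A contour with a point far out in some coordinate has exterior label `+`**: walk outwards
along that coordinate to the last contour point; its successor is an exterior collar site whose ball
sticks out of the cube. [cite: VanenterFernandezSokal1993, §4.3.1 Step 2; FriedliVelenik2017, §7.2.6] -/
theorem extLabel_eq_one_of_lt (hd : 2 ≤ d) (hb : 2 ≤ b) (hR : 2 ≤ R) {N : ℕ} {ω : SpinConfig (Site d)}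
    (hω : PlusOutside b N ω) {γ : Finset (Site d)} (hγ : IsContourOf b R ω γ) {g : Site d} (hg : g ∈ γ)
    {i : Fin d} (hgi : N < (g i).natAbs + R) : extLabel b R ω γ = 1 := by
  set ε : ℤ := if 0 ≤ g i then 1 else -1 with hε
  have hε1 : ε = 1 ∨ ε = -1 := by by_cases h : 0 ≤ g i <;> simp [hε, h]
  have hgh : g ∉ starExt γ := fun h => (not_mem_of_mem_starExt h) hg
  obtain ⟨t, -, hc⟩ := exists_last_on_ray hd hgh i hε1
  set c := Function.update g i (g i + (t + 1 : ℕ) * ε)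
  have hci : N < (c i).natAbs + R := by
    have : c i = g i + (t + 1 : ℕ) * ε := Function.update_self _ _ _
    rw [this]
    by_cases h : 0 ≤ g i
    · simp only [hε, h, if_true]; omega
    · simp only [hε, h, if_false]; omega
  rw [← label_eq_extLabel hd hb hR hγ hc]
  exact label_eq_one_of_lt hd hb (by omega) hω (isGood_of_mem_exBoundary_hull hd hγ hc) hci

/-- **A contour of exterior label `-1` lies well inside the cube.**
[cite: VanenterFernandezSokal1993, §4.3.1 Step 2] -/
theorem natAbs_add_le_of_extLabel (hd : 2 ≤ d) (hb : 2 ≤ b) (hR : 2 ≤ R) {N : ℕ} {ω : SpinConfig (Site d)}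
    (hω : PlusOutside b N ω) {γ : Finset (Site d)} (hγ : IsContourOf b R ω γ) (hl : extLabel b R ω γ = -1)
    {g : Site d} (hg : g ∈ γ) (i : Fin d) : (g i).natAbs + R ≤ N := by
  by_contra h
  have := extLabel_eq_one_of_lt hd hb hR hω hγ hg (i := i) (by omega)
  rw [hl] at this
  exact absurd this (by decide)

/-- **An interior component labelled `-1` lies well inside the cube**: from a point of the component
too far out, walk outwards to the first contour point; the point before it is a collar site labelled
`-1` whose ball sticks out of the cube. [cite: VanenterFernandezSokal1993, §4.3.1 Step 2; FriedliVelenik2017, §7.2.6] -/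
theorem natAbs_add_le_of_compLabel (hd : 2 ≤ d) (hb : 2 ≤ b) (hR : 2 ≤ R) {N : ℕ} {ω : SpinConfig (Site d)}
    (hω : PlusOutside b N ω) {γ : Finset (Site d)} (hγ : IsContourOf b R ω γ) {x : Site d} (hx : x ∈ starInt γ)
    (hl : compLabel b R ω (starIntComp γ x) = -1) {y : Site d} (hy : y ∈ starIntComp γ x) (i : Fin d) :
    (y i).natAbs + R ≤ N := by
  by_contra h
  push Not at h
  set ε : ℤ := if 0 ≤ y i then 1 else -1 with hε
  have hε1 : ε = 1 ∨ ε = -1 := by by_cases h : 0 ≤ y i <;> simp [hε, h]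
  have hyi : y ∈ starInt γ := starIntComp_subset γ x hy
  obtain ⟨t, ht1, htγ, hbefore⟩ := exists_first_on_ray hd hyi i hε1
  -- the collar site just before the first contour point
  set c := Function.update y i (y i + (t - 1 : ℕ) * ε) with hcdef
  have hcA : c ∈ starIntComp γ y := hbefore (t - 1) (by omega)
  have hcomp : starIntComp γ y = starIntComp γ x := starIntComp_eq_of_mem hd hx hy
  have hadj : (zdStar d).Adj c (Function.update y i (y i + t * ε)) := by
    have h1 : Function.update y i (y i + t * ε) = Function.update c i (c i + ε) := by
      rw [hcdef, Function.update_idem, Function.update_self]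
      congr 1
      have : ((t - 1 : ℕ) : ℤ) = t - 1 := by push_cast [Nat.cast_sub ht1]; ring
      rw [this]; ring
    rw [h1]
    exact zdGraph_le_zdStar (adj_update_add c i hε1)
  have hcB : c ∈ inBoundary (starIntComp γ x) := by
    refine mem_inBoundary.2 ⟨hcomp ▸ hcA, _, fun h' => ?_, hadj⟩
    exact ((mem_starInt hd).1 (starIntComp_subset γ x h')).1 htγ
  have hgood := isGood_of_mem_inBoundary_comp hd hγ hx hcB
  have hlab : label b R ω c = -1 := by rw [label_eq_compLabel hd hb hR hγ hx hcB, hl]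
  have hci : N < (c i).natAbs + R := by
    have : c i = y i + (t - 1 : ℕ) * ε := Function.update_self _ _ _
    rw [this]
    by_cases h0 : 0 ≤ y i
    · simp only [hε, h0, if_true]; omega
    · simp only [hε, h0, if_false]; omega
  have := natAbs_add_le_of_label_eq_neg_one hd hb (by omega) hω hgood hlab i
  omega

end Far

/-! ### Enclosure: a `-` spin in the `+` sea lies in the hull of a contour -/

section Enclosure

variable {b R : ℕ}

-- The `★`-component `starCompIn F z₀` of a site in a finite set, with `mem_starCompIn`,
-- `starCompIn_subset`, `mem_starCompIn_of_adj`, `starConn_starCompIn`, is reused from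
-- `…PositionSpaceRGNonGibbsianContours.lean` (namespace `SpacingPeierls`).
open SpacingPeierls (starCompIn mem_starCompIn starCompIn_subset mem_starCompIn_of_adj
  starConn_starCompIn)

variable (b R) in
/-- The bad set inside a cube. [cite: FriedliVelenik2017, §7.2.6 (the boundary set B(ω))] -/
def badSet (ω : SpinConfig (Site d)) (L : ℕ) : Finset (Site d) :=
  open Classical in (box d L).filter fun g => ¬ IsGood b R ω g

/-- Membership in the bad set. [folklore] -/
theorem mem_badSet {ω : SpinConfig (Site d)} {L : ℕ} {g : Site d} :
    g ∈ badSet b R ω L ↔ g ∈ box d L ∧ ¬ IsGood b R ω g := by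
  classical
  rw [badSet, mem_filter]

/-- **A `★`-component of the bad set (inside `box d (N+R)`) is a contour** when all internal spins
outside `box d N` are `+`. [cite: FriedliVelenik2017, §7.2.6] -/
theorem isContourOf_starCompIn_badSet (hR : 1 ≤ R) {N : ℕ} {ω : SpinConfig (Site d)} (hω : PlusOutside b N ω)
    {s₀ : Site d} (hs₀ : s₀ ∈ badSet b R ω (N + R)) : IsContourOf b R ω (starCompIn (badSet b R ω (N + R)) s₀) where
  nonempty := ⟨s₀, (mem_starCompIn hs₀).2 ReflTransGen.refl⟩
  starConn := starConn_starCompIn hs₀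
  bad g hg := (mem_badSet.1 (starCompIn_subset _ _ hg)).2
  maximal g hg y hgy hy := by
    by_contra hbad
    have hyB : y ∈ badSet b R ω (N + R) := by
      refine mem_badSet.2 ⟨?_, hbad⟩
      by_contra hyb
      exact hbad (isGood_of_not_mem_box (Or.inl hR) hω hyb)
    exact hy (mem_starCompIn_of_adj hs₀ hg hyB hgy)

/-- **Enclosure**: if all internal spins outside `box d N` are `+` and the internal spin at `u` is
`-1`, then `u` lies in the hull (support or interior) of some contour contained in `box d (N + R)`.
Proof: walks from `u` to the far region run through good sites only if all their sites are good, and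
then carry the label `-1` of `u` to the label `+1` of the far region — so the bad set separates `u`
from the far region; a minimal separating subset of it lies in a single `★`-component by Timár's
lemma (the `★`-triangles generate the cycle space of `ℤ^{d★}` and their vertices are pairwise
`★`-adjacent), and that component is the contour. [cite: Timar2013, Lemma 1; FriedliVelenik2017, §7.2.6 and App. B.15] -/
theorem exists_contour_enclosing (hd : 2 ≤ d) (hb : 2 ≤ b) (hR : 2 ≤ R) {N : ℕ} {ω : SpinConfig (Site d)}
    (hω : PlusOutside b N ω) {u : Site d} (hui : ¬ IsSpImageSite d b u) (hu : ω u = -1) :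
    ∃ γ : Finset (Site d), IsContourOf b R ω γ ∧ γ ⊆ box d (N + R) ∧ u ∉ starExt γ := by
  classical
  set L := N + R with hL
  set B := badSet b R ω L with hB
  have hBbox : B ⊆ box d L := fun g hg => (mem_badSet.1 hg).1
  -- the easy case: `u` itself is bad
  by_cases huB : u ∈ B
  · refine ⟨starCompIn B u, isContourOf_starCompIn_badSet (by omega) hω huB,
      (starCompIn_subset B u).trans hBbox, fun h => ?_⟩
    exact (not_mem_of_mem_starExt h) ((mem_starCompIn huB).2 ReflTransGen.refl)
  -- good sites off `B`
  have hgood_of : ∀ w, w ∉ B → IsGood b R ω w := by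
    intro w hw
    by_cases hwb : w ∈ box d L
    · by_contra h; exact hw (mem_badSet.2 ⟨hwb, h⟩)
    · exact isGood_of_not_mem_box (Or.inl (by omega)) hω hwb
  -- `u` is labelled `-1`, far points `+1`
  have hu_label : label b R ω u = -1 := by
    rw [← label_spec (hgood_of u huB) (mem_ball_self R u) hui, hu]
  have hfar_label : ∀ y ∈ farSet d L, label b R ω y = 1 := by
    intro y hy
    have hyb : y ∉ box d L := mem_farSet_iff_not_mem_box.1 hy
    obtain ⟨i, hi⟩ : ∃ i, L < (y i).natAbs := hy
    exact label_eq_one_of_lt hd hb (by omega) hω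
      (isGood_of_not_mem_box (Or.inl (by omega)) hω hyb) (i := i) (by omega)
  -- separation: every `★`-walk from `u` to the far region meets `B`
  have hsepB : ∀ y ∈ farSet d L, ∀ p : (zdStar d).Walk u y, ∃ s ∈ B, s ∈ p.support := by
    intro y hy p
    by_contra hcon
    push Not at hcon
    have hsupp : ∀ w ∈ p.support, w ∈ {w : Site d | IsGood b R ω w} := fun w hw =>
      hgood_of w fun hwB => hcon w hwB hw
    have hchain := reflTransGen_of_walk p hsupp
    have := label_eq_of_reflTransGen (by omega) hb hR (fun c hc => hc) hchain
    rw [hu_label, hfar_label y hy] at this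
    exact absurd this (by decide)
  -- a separating subset of `B` of minimal cardinality
  set 𝒮 : Finset (Finset (Site d)) := B.powerset.filter fun S =>
    ∀ y ∈ farSet d L, ∀ p : (zdStar d).Walk u y, ∃ s ∈ S, s ∈ p.support with h𝒮
  have hB𝒮 : B ∈ 𝒮 := mem_filter.2 ⟨mem_powerset.2 Subset.rfl, hsepB⟩
  obtain ⟨S, hS𝒮, hSmin⟩ := 𝒮.exists_min_image Finset.card ⟨B, hB𝒮⟩
  obtain ⟨hSB, hSsep⟩ := mem_filter.1 hS𝒮
  rw [mem_powerset] at hSB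
  -- `S` is non-empty: `u` is `★`-connected to the far corner
  have hSne : S.Nonempty := by
    by_contra hcon
    rw [not_nonempty_iff_eq_empty] at hcon
    set y₀ : Site d := fun _ => (L : ℤ) + 1
    have hy₀ : y₀ ∈ farSet d L := corner_mem_farSet (by omega) le_rfl
    obtain ⟨p, -⟩ := exists_walk_of_reflTransGen (reflTransGen_starRel_univ u y₀) (Set.mem_univ u)
    obtain ⟨s, hs, -⟩ := hSsep y₀ hy₀ p
    rw [hcon] at hs
    exact notMem_empty s hs
  obtain ⟨s₀, hs₀⟩ := hSne
  have hs₀B : s₀ ∈ B := hSB hs₀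
  set γ := starCompIn B s₀ with hγdef
  have hγ : IsContourOf b R ω γ := isContourOf_starCompIn_badSet (by omega) hω hs₀B
  have hγB : γ ⊆ B := starCompIn_subset B s₀
  -- minimality of `S`: for each `s ∈ S` some walk to the far region meets `S` only in `s`
  have hmin : ∀ s ∈ S, ∃ y ∈ farSet d L, ∃ p : (zdStar d).Walk u y, ∀ w ∈ p.support, w ∈ S → w = s := by
    intro s hs
    have hnot : S.erase s ∉ 𝒮 := fun h => by
      have := hSmin _ h
      have := card_erase_lt_of_mem hs
      omega
    have hnot' : ¬ ∀ y ∈ farSet d L, ∀ p : (zdStar d).Walk u y, ∃ s' ∈ S.erase s, s' ∈ p.support := fun h =>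
      hnot (mem_filter.2 ⟨mem_powerset.2 ((erase_subset s S).trans hSB), h⟩)
    push Not at hnot'
    obtain ⟨y, hy, p, hp⟩ := hnot'
    refine ⟨y, hy, p, fun w hw hwS => ?_⟩
    by_contra hws
    exact hp w (mem_erase.2 ⟨hws, hwS⟩) hw
  -- `S ⊆ γ` by Timár's lemma
  have hSγ : S ⊆ γ := by
    by_contra hcon
    obtain ⟨s₂, hs₂S, hs₂γ⟩ := Finset.not_subset.1 hcon
    have huS : u ∉ S := fun h => huB (hSB h)
    have hYS : ∀ y ∈ farSet d L, y ∉ S := fun y hy hyS =>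
      (mem_farSet_iff_not_mem_box.1 hy) (hBbox (hSB hyS))
    have hY : ∀ y ∈ farSet d L, ∀ y' ∈ farSet d L, ∃ p : (zdStar d).Walk y y', ∀ w ∈ p.support, w ∈ farSet d L :=
      fun y hy y' hy' => exists_walk_of_reflTransGen (starConn_farSet hd L y hy y' hy') hy
    obtain ⟨s₁, hs₁, s₂', hs₂', hadj⟩ := minimalSeparator_adjacent_across_gen (G := zdStar d)
      (generatesCycles_zdStar d) (fun C hC => isEvenEdgeSet_of_mem_starTriangles hC)
      (fun C hC e he => mem_edgeSet_of_mem_starTriangles hC he) (adjPlus := (zdStar d).Adj)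
      (fun C hC e he e' he' a ha c hc hne => adj_of_mem_starTriangle hC he ha he' hc hne)
      huS hYS hY hSsep hmin (S₁ := S.filter (· ∈ γ)) (S₂ := S.filter (· ∉ γ))
      (fun s => by simp only [mem_filter]; tauto) ⟨s₀, mem_filter.2 ⟨hs₀, (mem_starCompIn hs₀B).2 ReflTransGen.refl⟩⟩
      ⟨s₂, mem_filter.2 ⟨hs₂S, hs₂γ⟩⟩ (disjoint_filter_filter_not S S (· ∈ γ))
    obtain ⟨-, hs₁γ⟩ := mem_filter.1 hs₁
    obtain ⟨hs₂'S, hs₂'γ⟩ := mem_filter.1 hs₂'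
    exact hs₂'γ (mem_starCompIn_of_adj hs₀B hs₁γ (hSB hs₂'S) hadj)
  refine ⟨γ, hγ, hγB.trans hBbox, fun hue => ?_⟩
  obtain ⟨-, y, hy, hchain⟩ := (mem_starExt_iff hd (hγB.trans hBbox)).1 hue
  obtain ⟨p, hp⟩ := exists_walk_of_reflTransGen hchain (not_mem_of_mem_starExt hue)
  obtain ⟨s, hs, hsp⟩ := hSsep y hy p
  exact hp s hsp (hSγ hs)

/-- **Anchor**: a `★`-connected finite set whose hull contains `u` lies in the ball of radius
`#γ - 1` about `u` (in every coordinate `γ` has points on both sides of `u`, and the coordinates of a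
`★`-connected set form integer intervals of length `< #γ`).
[cite: FriedliVelenik2017, §7.4.3 (the support of a contour surrounding a point)] -/
theorem subset_ball_of_not_mem_starExt (hd : 2 ≤ d) {γ : Finset (Site d)} (hγ : StarConn (γ : Set (Site d)))
    {u : Site d} (hu : u ∉ starExt γ) : γ ⊆ ball (#γ - 1) u := by
  intro g hg
  refine mem_ball.2 fun i => ?_
  -- points of `γ` on both sides of `u` in coordinate `i`
  obtain ⟨x₁, hx₁, hux₁⟩ : ∃ x₁ ∈ γ, u i ≤ x₁ i := by
    by_contra h; push Not at h
    exact hu (mem_starExt_of_forall_lt hd i h)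
  obtain ⟨x₂, hx₂, hux₂⟩ : ∃ x₂ ∈ γ, x₂ i ≤ u i := by
    by_contra h; push Not at h
    exact hu (mem_starExt_of_forall_gt hd i h)
  -- coordinates of a `★`-connected set form an interval of length `< #γ`
  have hint : ∀ a ∈ γ, ∀ c ∈ γ, a i ≤ c i → c i - a i + 1 ≤ #γ := by
    intro a ha c hc hac
    have hsub : (Finset.Icc (a i) (c i)) ⊆ γ.image (· i) := by
      intro z hz
      rw [Finset.mem_Icc] at hz
      obtain ⟨w, hw, hwz⟩ := exists_apply_eq_of_starConn hγ i ha hc hz.1 hz.2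
      exact mem_image.2 ⟨w, hw, hwz⟩
    have h1 := card_le_card hsub
    rw [Int.card_Icc] at h1
    have h2 : #(γ.image (· i)) ≤ #γ := card_image_le
    have : (c i + 1 - a i).toNat = c i - a i + 1 := by omega
    omega
  rcases le_total (g i) (u i) with hgu | hgu
  · have := hint g hg x₁ hx₁ (hgu.trans hux₁)
    omega
  · have := hint x₂ hx₂ g hg (hux₂.trans hgu)
    omega

end Enclosure


end Literature.Barriers.CriticalPhenomena.NonGibbs

end
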